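import Literature.Computability.Complexity.SuccinctWidthBricks
import HarnessLib

/-!
# Williams' Fact 3.1 from its skeleton form: simulating random access to the input

Literature / circuit complexity (serves `williams_acc` through `Williams2014Transfer.lean`, whose
deep leaf `Williams2014_fact_3_1` — the efficient succinct Cook–Levin reduction, Williams 2014,
Fact 3.1 — is the target of this decomposition). The printed derivation of Fact 3.1 (Williams
2014, p. 8) has two ingredients:

1. Theorem 3.3 (Tourlakis 2001; Fortnow–Lipton–van Melkebeek–Viglas 2005, §3.1, after Cook 1988,
   Pippenger–Fischer 1979, Hennie–Stearns 1966, Gurevich–Shelah 1989, Robson 1991): every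
   `L ∈ NTIME[n]` reduces to `3SAT` instances of `n (log n)ᶜ` clauses "whose `i`-th clause is
   computable, given `i` in binary and RANDOM ACCESS to the input, in `O((log n)ᶜ)` time"; in
   the form printed by Fortnow et al. (proof of their Thm. 3.4): "`φ` is of the form
   `(∧ᵢ₌₁ⁿ xᵢ = yᵢ) ∧ ψ` where `ψ` only uses the variables `y`" and depends on `n` alone, each bit
   of `ψ` being computable in polylogarithmic time — i.e. the `i`-th clause of the instance is a
   function of `n`, `i` and of the single input bit `xᵢ`; applied, by padding ("substituting `2ⁿ`
   in place of `n`"), to the language `L' = {x01^{2^{|x|}} | x ∈ L} ∈ NTIME[n]` of an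
   `L ∈ NTIME[2ⁿ]`: `2ⁿ · poly(n)` clauses, each computable in `poly(n)` time;
2. "As it is easy to simulate random accesses to an input of the form `x01^{2^{|x|}}` with a
   uniform `poly(|x|)` size circuit, one can simulate the `O((log n)ᶜ)` time algorithm of
   Theorem 3.3 on `L'`, with a uniform `poly(|x|ᶜ)` size circuit."

This file vendors ingredient 1 at the exponential level, over the tree's verifier-form `NTIME`
(`Nondeterministic.lean`) and its succinct reductions (`IsSuccinctReduction`,
`Williams2014Transfer.lean`), as ONE named fact, and PROVES ingredient 2:

* `IsSkeletonReduction c L sk` — a **skeleton reduction** of `L` with constant `c`: a clause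
  function `sk : ℕ → ℕ → Bool → Clause ℕ`, `sk n i b` = "the `i`-th clause on inputs of length
  `n` whose `i`-th bit is `b`" (width `≤ 3`, variables `< 2 ^ (n + c log₂ n + c)`, the fixed
  tautology `tautClause` from index `2 ^ (n + c log₂ n + c)` on), computable from the query
  `⟨1ⁿ, ⟨bin i, b⟩⟩` (`encodeSkelQuery`) in time `a ℓᶜ + a`, such that `x ∈ L` iff the
  instantiated formula (`skeletonClauses sk x i = sk |x| i xᵢ`, clauses `i < 2 ^ (n + c log₂ n + c)`)
  is satisfiable;
* `Williams2014_fact_3_1_skeleton` — **named fact**: there is a universal `c` such that every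
  `L ∈ NTIME (2 ^ ·)` has a skeleton reduction with constant `c` (Williams 2014, Fact 3.1 with
  Thm. 3.3, in the skeleton form of Fortnow et al. 2005, §3.1);
* **proved** — `skelPre ∈ FP`: the random-access pre-processing `⟨x, bin i⟩ ↦ ⟨1^{|x|}, ⟨bin i,
  xᵢ⟩⟩` assembled from the tree's bricks (`binToUnaryFn`, `bitAtFn`, `take1Fn` of
  `FPStringBricks.lean`, `onesFn`, `fanoutFn`); `exists_isSuccinctReduction_of_skeleton`: there
  is a universal `D` such that every skeleton reduction with constant `c` instantiates to a
  succinct reduction with constant `c + D` (composition of machines `TimeComputable.comp_holds`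
  with the explicit exponent bookkeeping `a ℓᶜ + a ↦ A ℓ^{c + D} + A`, `D` coming from the
  polynomial of `skelPre`; the extra clauses are tautologies, `satisfiable_iff_of_le`); hence
  **`Williams2014_fact_3_1_of_skeleton : Williams2014_fact_3_1_skeleton → Williams2014_fact_3_1`**.

After this file the trust base of `Williams2014_fact_3_1` is the single leaf
`Williams2014_fact_3_1_skeleton`, whose own proof is a theory (a quasi-linear-size,
locally computable encoding of `2ⁿ`-time multi-stack (`TM2`) computations: oblivious simulation
or sorting-network consistency checking, the Tseitin transform, and a polynomial-time clause
generator with an `L`-independent exponent); it is NOT attempted here.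

## Faithfulness notes

* The query of a skeleton clause carries `n` in UNARY (`1ⁿ`): at the exponential level the
  printed time for one clause is `poly(n)` (Williams: "a uniform `poly(|x|ᶜ)` size circuit"), and a
  clause code may have `Θ(n)` bits (variable indices `< 2 ^ (n + c log₂ n + c)`), so a budget
  polynomial in `|bin n| + |bin i|` would be void for small `i`. The single bit `b` is the
  random access: by the printed form `(∧ xᵢ = yᵢ) ∧ ψ` clause `i` reads at most the input bit
  `xᵢ` (after plugging the constants `xᵢ`, `xᵢ = yᵢ` is the unit clause `yᵢ` or `¬yᵢ`), and we
  allow, more liberally, every clause `i` to depend on `(n, i, xᵢ)`.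
* The padding field `eq_tautClause` (clauses from index `2 ^ (n + c log₂ n + c)` on are the
  fixed tautology `x₀ ∨ ¬x₀`) is what makes the constant of a reduction freely enlargeable
  (`satisfiable_iff_of_le`), which the universal-exponent bookkeeping of Fact 3.1 needs; every
  construction has it for free.
* As in `IsSuccinctReduction`, `c = 0` makes the time field unsatisfiable (harmless).

## References

* R. Williams, *Nonuniform ACC circuit lower bounds*, J. ACM 61 (2014), Fact 3.1, Thm. 3.3 and
  the derivation of Fact 3.1 on p. 8 [Williams2014].
* L. Fortnow, R. Lipton, D. van Melkebeek, A. Viglas, *Time-space lower bounds for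
  satisfiability*, J. ACM 52 (2005) 835–865, §3.1 (proof of Thm. 3.4) [FortnowEtAl2005].
* I. Tourlakis, *Time-space tradeoffs for SAT on nonuniform machines*, JCSS 63 (2001) 268–287.
* S. A. Cook, *Short propositional formulas represent nondeterministic computations*, IPL 26
  (1988) 269–270; N. Pippenger, M. Fischer, *Relations among complexity measures*, J. ACM 26
  (1979); F. Hennie, R. Stearns, *Two-tape simulation of multitape Turing machines*, J. ACM 13
  (1966) [HennieStearns1966].
* S. Arora, B. Barak, *Computational Complexity: A Modern Approach*, CUP 2009, §1.3 [AroraBarakCC2009].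
-/

namespace Literature.Computability.Complexity

open _root_.Computability Turing Polynomial Brick

/-! ### Skeleton reductions -/

/-- The fixed tautological clause `x₀ ∨ ¬x₀`, used to pad a presented formula beyond its
meaningful clauses. [folklore] -/
def tautClause : Clause ℕ := [(0, true), (0, false)]

/-- `tautClause` is true under every assignment. [folklore] -/
@[simp] theorem eval_tautClause (σ : ℕ → Bool) : Clause.eval σ tautClause = true := by
  cases h : σ 0 <;> simp [tautClause, Clause.eval, Literal.eval, h]

/-- `tautClause` has two literals. [folklore] -/
@[simp] theorem length_tautClause : tautClause.length = 2 := rfl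
/-- The query presentation of a skeleton clause: `(n, i, b) ↦ ⟨1ⁿ, ⟨bin i, b⟩⟩` (`boolPair`,
Mathlib's `unaryEncodeNat`/`encodeNat`; the input length in unary, the clause index in binary,
the accessed input bit). [folklore] -/
def encodeSkelQuery (q : ℕ × ℕ × Bool) : List Bool :=
  boolPair (unaryEncodeNat q.1) (boolPair (encodeNat q.2.1) [q.2.2])

/-- Length of a skeleton query: `2n + 2 |bin i| + 5` (`|1ⁿ| = n` is Mathlib's
`unary_decode_encode_nat`). [folklore] -/
@[simp] theorem length_encodeSkelQuery (q : ℕ × ℕ × Bool) :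
    (encodeSkelQuery q).length = 2 * q.1 + 2 * (encodeNat q.2.1).length + 5 := by
  have h : (unaryEncodeNat q.1).length = q.1 := unary_decode_encode_nat q.1
  simp only [encodeSkelQuery, length_boolPair, h, List.length_singleton]
  omega

/-- `encodeSkelQuery` is injective. [folklore] -/
theorem encodeSkelQuery_injective : Function.Injective encodeSkelQuery := by
  rintro ⟨n, i, b⟩ ⟨n', i', b'⟩ h
  have h' := congr_arg boolUnpair h
  simp only [encodeSkelQuery, boolUnpair_boolPair, Prod.mk.injEq] at h'
  obtain ⟨hn, hib⟩ := h'
  have h2 := congr_arg boolUnpair hib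
  simp only [boolUnpair_boolPair, Prod.mk.injEq, List.cons.injEq, and_true] at h2
  obtain ⟨hi, rfl⟩ := h2
  have hn' : n = n' := by
    rw [← unary_decode_encode_nat n, ← unary_decode_encode_nat n', hn]
  have hi' : i = i' := by
    rw [← decode_encodeNat i, ← decode_encodeNat i', hi]
  subst hn'; subst hi'; rfl

/-- The clause function presented by a skeleton `sk` on the input `x`: clause `i` is
`sk |x| i xᵢ`, the bit `xᵢ` read as `false` past the end of `x` (Fortnow et al. 2005, §3.1: the
instance `(∧ᵢ xᵢ = yᵢ) ∧ ψ` with the input bits plugged in). [cite: FortnowEtAl2005, §3.1] -/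
def skeletonClauses (sk : ℕ → ℕ → Bool → Clause ℕ) (x : List Bool) (i : ℕ) : Clause ℕ :=
  sk x.length i (x.getD i false)

/-- **Skeleton reductions to `3SAT`** with constant `c` (the data of Williams 2014, Fact 3.1 /
Thm. 3.3 in the form printed by Fortnow et al. 2005, §3.1: "`φ` is of the form
`(∧ᵢ₌₁ⁿ xᵢ = yᵢ) ∧ ψ` where `ψ` only uses the variables `y`", `ψ` depending on `n` alone, each of
its bits locally computable): a clause function `sk n i b` of the input LENGTH `n`, the clause
index `i` and ONE input bit `b` (the bit `xᵢ` when instantiated, `skeletonClauses`) such that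
every clause has at most `3` literals on variables `< 2 ^ (n + c log₂ n + c)`; clauses from
index `2 ^ (n + c log₂ n + c)` on are the fixed tautology `tautClause`; the map
`⟨1ⁿ, ⟨bin i, b⟩⟩ ↦ code (sk n i b)` (`encodeSkelQuery`, `encodingClause`) is computable in time
`a ℓᶜ + a` on Mathlib's `TM2` (`TimeComputable`; the exponent is the universal `c`, the constant
`a` depends on `L`); and `x ∈ L` iff the instantiated formula
`succinctCNF c (skeletonClauses sk) x` (clauses `i < 2 ^ (n + c log₂ n + c)`, `n = |x|`) is
satisfiable. [cite: Williams2014, Fact 3.1 and Thm. 3.3] -/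
structure IsSkeletonReduction (c : ℕ) (L : Language Bool) (sk : ℕ → ℕ → Bool → Clause ℕ) :
    Prop where
  /-- `3CNF`: every clause has at most three literals. -/
  length_le : ∀ (n i : ℕ) (b : Bool), (sk n i b).length ≤ 3
  /-- Variable indices have at most `n + c log₂ n + c` bits. -/
  var_lt : ∀ (n i : ℕ) (b : Bool), ∀ l ∈ sk n i b, l.1 < 2 ^ succinctWidth c n
  /-- Padding: from index `2 ^ (n + c log₂ n + c)` on, the clauses are the fixed tautology. -/
  eq_tautClause : ∀ (n i : ℕ) (b : Bool), 2 ^ succinctWidth c n ≤ i → sk n i b = tautClause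
  /-- The clause `sk n i b` is computable from `⟨1ⁿ, ⟨bin i, b⟩⟩` in time `a ℓᶜ + a`. -/
  time : ∃ a : ℕ, TimeComputable encodeSkelQuery encodingClause.encode
    (fun q : ℕ × ℕ × Bool => sk q.1 q.2.1 q.2.2) fun ℓ => a * ℓ ^ c + a
  /-- Correctness: `x ∈ L` iff the instantiated formula is satisfiable. -/
  mem_iff : ∀ x : List Bool, x ∈ L ↔ (succinctCNF c (skeletonClauses sk) x).Satisfiable

/-- **Williams 2014, Fact 3.1 in skeleton form** (= Thm. 3.3 of Tourlakis 2001 / Fortnow et al.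
2005 after Williams' padding `n ↦ 2ⁿ`, in the form `(∧ᵢ xᵢ = yᵢ) ∧ ψ` printed by Fortnow et al.
2005, §3.1): "There is a constant `c > 0` such that for every `L ∈ NTIME[2ⁿ]`" the `3SAT`
instance of `x` — "`F_{Cₓ}` of `2ⁿ · poly(n)` size", "`x ∈ L` if and only if [it] is
satisfiable" — has `2 ^ (n + c log₂ n + c)` clauses whose `i`-th clause depends only on `n = |x|`,
`i` and the input bit `xᵢ` and is computable from `⟨1ⁿ, ⟨bin i, xᵢ⟩⟩` in `poly(n)` time with the
universal exponent `c` (Williams: Thm. 3.3 "outputs the `i`th clause … in `O((log n)ᶜ)` time"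
with random access to the padded input `x01^{2^{|x|}}` of length `N`, `log N = Θ(n)`). Over the
tree's verifier-form `NTIME` on Mathlib's multi-stack `TM2` (Williams 2014, §2: "the choice of
uniform machine model is not crucial"; Fortnow et al. prove the form for multitape machines via
the oblivious two-tape simulation of Hennie–Stearns / Pippenger–Fischer and Cook 1988).
Fact 3.1 itself follows by simulating the random access (`Williams2014_fact_3_1_of_skeleton`).
[cite: Williams2014, Fact 3.1 and Thm. 3.3] -/
def Williams2014_fact_3_1_skeleton : Prop :=
  ∃ c : ℕ, ∀ L ∈ NTIME (fun n => 2 ^ n), ∃ sk : ℕ → ℕ → Bool → Clause ℕ,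
    IsSkeletonReduction c L sk

/-! ### Enlarging the constant: the padded clauses are tautologies -/

/-- `succinctWidth` is monotone in the constant. [folklore] -/
theorem succinctWidth_mono {c c' : ℕ} (h : c ≤ c') (n : ℕ) :
    succinctWidth c n ≤ succinctWidth c' n := by
  unfold succinctWidth
  gcongr

/-- The instantiated formula of a skeleton reduction with constant `c` is equisatisfiable with
the longer one presented with any constant `c' ≥ c`: the extra clauses are `tautClause`.
[folklore] -/
theorem IsSkeletonReduction.satisfiable_iff_of_le {c c' : ℕ} {L : Language Bool}
    {sk : ℕ → ℕ → Bool → Clause ℕ} (h : IsSkeletonReduction c L sk) (hcc' : c ≤ c')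
    (x : List Bool) :
    (succinctCNF c (skeletonClauses sk) x).Satisfiable ↔
      (succinctCNF c' (skeletonClauses sk) x).Satisfiable := by
  have hw : 2 ^ succinctWidth c x.length ≤ 2 ^ succinctWidth c' x.length :=
    Nat.pow_le_pow_right Nat.two_pos (succinctWidth_mono hcc' _)
  constructor
  · rintro ⟨σ, hσ⟩
    refine ⟨σ, eval_succinctCNF_eq_true_iff.2 fun i hi => ?_⟩
    by_cases hi' : i < 2 ^ succinctWidth c x.length
    · exact eval_succinctCNF_eq_true_iff.1 hσ i hi'
    · rw [skeletonClauses, h.eq_tautClause _ _ _ (Nat.not_lt.1 hi')]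
      exact eval_tautClause σ
  · rintro ⟨σ, hσ⟩
    exact ⟨σ, eval_succinctCNF_eq_true_iff.2 fun i hi =>
      eval_succinctCNF_eq_true_iff.1 hσ i (hi.trans_le hw)⟩

/-! ### Simulating random access: `⟨x, bin i⟩ ↦ ⟨1^{|x|}, ⟨bin i, xᵢ⟩⟩` is polynomial time -/

/-- The symbol of `x` at the position given by the binary index of the query, as a word of
length `≤ 1`: `⟨x, bin i⟩ ↦ (x ⇂ min i |x|) ↾ 1` (the position in unary by `binToUnaryFn` with
ruler `x`, the symbol there by `bitAtFn`; empty past the end of `x`). [folklore] -/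
noncomputable def skelPosFn : List Bool → List Bool :=
  bitAtFn ∘ fanoutFn binToUnaryFn fstF

/-- Value of `skelPosFn` on a clause query. [folklore] -/
theorem skelPosFn_encodeClauseQuery (x : List Bool) (i : ℕ) :
    skelPosFn (encodeClauseQuery (x, i)) = (x.drop (min i x.length)).take 1 := by
  simp only [skelPosFn, Function.comp_apply, encodeClauseQuery, fanoutFn_apply, fstF_boolPair,
    binToUnaryFn_boolPair, bitsToNat_encodeNat, bitAtFn_boolPair, ones, List.length_replicate]

/-- `skelPosFn ∈ FP`. [cite: AroraBarakCC2009, §1.3] -/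
theorem skelPosFn_mem_FP : skelPosFn ∈ FP :=
  comp_mem_FP bitAtFn_mem_FP (fanoutFn_mem_FP binToUnaryFn_mem_FP fstF_mem_FP)

/-- The accessed bit as a one-symbol word, `⟨x, bin i⟩ ↦ [xᵢ]` (`[false]` past the end of `x`):
a default `0` appended to `skelPosFn` and one symbol kept (`take1Fn`). [folklore] -/
noncomputable def skelBitFn : List Bool → List Bool :=
  take1Fn ∘ fun z => skelPosFn z ++ [false]

/-- Value of `skelBitFn` on a clause query. [folklore] -/
theorem skelBitFn_encodeClauseQuery (x : List Bool) (i : ℕ) :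
    skelBitFn (encodeClauseQuery (x, i)) = [x.getD i false] := by
  simp only [skelBitFn, Function.comp_apply, skelPosFn_encodeClauseQuery, take1Fn]
  by_cases h : i < x.length
  · rw [Nat.min_eq_left h.le, List.take_one_drop_eq_of_lt_length h, List.getD_eq_getElem _ _ h]
    rfl
  · rw [Nat.min_eq_right (Nat.not_lt.1 h), List.drop_length, List.getD_eq_default _ _
      (Nat.not_lt.1 h)]
    rfl

/-- `skelBitFn ∈ FP`. [cite: AroraBarakCC2009, §1.3] -/
theorem skelBitFn_mem_FP : skelBitFn ∈ FP :=
  comp_mem_FP take1Fn_mem_FP (append_mem_FP skelPosFn_mem_FP (const_mem_FP [false]))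

/-- **The random-access pre-processing** `skelPre ⟨x, bin i⟩ = ⟨1^{|x|}, ⟨bin i, xᵢ⟩⟩`: the
input length in unary (`onesFn`), the index copied, the accessed bit (`skelBitFn`) — Williams
2014, p. 8: "it is easy to simulate random accesses to an input of the form `x01^{2^{|x|}}`".
[cite: Williams2014, proof sketch of Fact 3.1 (p. 8)] -/
noncomputable def skelPre : List Bool → List Bool :=
  fanoutFn (onesFn ∘ fstF) (fanoutFn sndF skelBitFn)

/-- Value of `skelPre` on a clause query: the skeleton query of `(|x|, i, xᵢ)`. [folklore] -/
theorem skelPre_encodeClauseQuery (x : List Bool) (i : ℕ) :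
    skelPre (encodeClauseQuery (x, i)) = encodeSkelQuery (x.length, i, x.getD i false) := by
  rw [skelPre, fanoutFn_apply, fanoutFn_apply, skelBitFn_encodeClauseQuery]
  simp [encodeClauseQuery, encodeSkelQuery, onesFn]

/-- `skelPre ∈ FP`. [cite: AroraBarakCC2009, §1.3] -/
theorem skelPre_mem_FP : skelPre ∈ FP :=
  fanoutFn_mem_FP (comp_mem_FP onesFn_mem_FP fstF_mem_FP)
    (fanoutFn_mem_FP sndF_mem_FP skelBitFn_mem_FP)

/-- The pre-processing in typed form: the map `(x, i) ↦ (|x|, i, xᵢ)` is computable from clause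
queries to skeleton queries within a polynomial time bound. [cite: AroraBarakCC2009, §1.3] -/
theorem exists_timeComputable_skelPre :
    ∃ p : Polynomial ℕ, TimeComputable encodeClauseQuery encodeSkelQuery
      (fun q : List Bool × ℕ => (q.1.length, q.2, q.1.getD q.2 false)) fun ℓ => p.eval ℓ := by
  obtain ⟨p, M, hM⟩ := skelPre_mem_FP
  refine ⟨p, M, fun q => ?_⟩
  obtain ⟨x, i⟩ := q
  have h := hM (encodeClauseQuery (x, i))
  simp only [id] at h
  rwa [skelPre_encodeClauseQuery] at h

/-- The skeleton query of `(|x|, i, xᵢ)` is at most twice as long as the clause query `⟨x, bin i⟩`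
(plus one). [folklore] -/
theorem length_encodeSkelQuery_le (x : List Bool) (i : ℕ) :
    (encodeSkelQuery (x.length, i, x.getD i false)).length ≤
      2 * (encodeClauseQuery (x, i)).length + 1 := by
  simp only [length_encodeSkelQuery, encodeClauseQuery, length_boolPair]
  omega

/-! ### Exponent bookkeeping -/

/-- `ℓᵉ ≤ ℓᵉ' + 1` for `e ≤ e'` (the `+ 1` covers `ℓ = 0`, `e = 0`). [folklore] -/
theorem pow_le_pow_add_one_of_le {e e' : ℕ} (ℓ : ℕ) (h : e ≤ e') : ℓ ^ e ≤ ℓ ^ e' + 1 := by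
  rcases Nat.eq_zero_or_pos ℓ with rfl | hℓ
  · rcases Nat.eq_zero_or_pos e with rfl | he
    · simp
    · simp [Nat.pos_iff_ne_zero.1 he]
  · exact (Nat.pow_le_pow_right hℓ h).trans (Nat.le_succ _)

/-- `(2ℓ + 1)ᶜ ≤ 3ᶜ ℓᶜ + 1`. [folklore] -/
theorem two_mul_add_one_pow_le (ℓ c : ℕ) : (2 * ℓ + 1) ^ c ≤ 3 ^ c * ℓ ^ c + 1 := by
  rcases Nat.eq_zero_or_pos ℓ with rfl | hℓ
  · simp
  · calc (2 * ℓ + 1) ^ c ≤ (3 * ℓ) ^ c := Nat.pow_le_pow_left (by omega) c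
      _ = 3 ^ c * ℓ ^ c := mul_pow 3 ℓ c
      _ ≤ 3 ^ c * ℓ ^ c + 1 := Nat.le_succ _

/-! ### Skeleton reductions instantiate to succinct reductions -/

/-- **A skeleton reduction instantiates to a succinct reduction, with a universal shift of the
constant.** There is `D` such that for every `c`, `L` and every skeleton reduction `sk` of `L`
with constant `c`, the clause function `skeletonClauses sk` (`(x, i) ↦ sk |x| i xᵢ`) is a
succinct reduction of `L` with constant `c + D`: widths and variable bounds carry over
(`succinctWidth` is monotone), the clauses of index `≥ 2 ^ (n + c log₂ n + c)` are tautologies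
(`satisfiable_iff_of_le`), and the clause machine is the pre-processing `skelPre` (polynomial
`p`, `D = k + 1` for `p ≤ c₀ ℓᵏ + c₀`) followed by the skeleton machine
(`TimeComputable.comp_holds`): time `C (p ℓ + a (2ℓ+1)ᶜ + a + 2ℓ + 1) + C ≤ A ℓ^{c+D} + A`.
This is Williams' "one can simulate the `O((log n)ᶜ)` time algorithm of Theorem 3.3 on `L'`"
(2014, p. 8). [cite: Williams2014, proof sketch of Fact 3.1 (p. 8)] -/
theorem exists_isSuccinctReduction_of_skeleton :
    ∃ D : ℕ, ∀ (c : ℕ) (L : Language Bool) (sk : ℕ → ℕ → Bool → Clause ℕ),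
      IsSkeletonReduction c L sk → IsSuccinctReduction (c + D) L (skeletonClauses sk) := by
  obtain ⟨p, hp⟩ := exists_timeComputable_skelPre
  obtain ⟨c₀, k, hk⟩ := exists_eval_le_mul_pow_add p
  refine ⟨k + 1, fun c L sk h => ⟨fun x i => h.length_le _ _ _, fun x i l hl => ?_, ?_, fun x => ?_⟩⟩
  · exact (h.var_lt _ _ _ l hl).trans_le
      (Nat.pow_le_pow_right Nat.two_pos (succinctWidth_mono (Nat.le_add_right c _) _))
  · -- the clause machine: pre-processing, then the skeleton machine
    obtain ⟨a, ha⟩ := h.time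
    have hmono : Monotone fun ℓ : ℕ => a * ℓ ^ c + a := fun m m' hmm' => by
      dsimp only
      gcongr
    have hcomp := @TimeComputable.comp_holds (List Bool × ℕ) (ℕ × ℕ × Bool) (Clause ℕ) Bool Bool Bool
    unfold TimeComputable.comp at hcomp
    obtain ⟨C, hC⟩ := @hcomp encodeClauseQuery encodeSkelQuery encodingClause.encode
      (fun q : List Bool × ℕ => (q.1.length, q.2, q.1.getD q.2 false))
      (fun q : ℕ × ℕ × Bool => sk q.1 q.2.1 q.2.2) (fun ℓ => p.eval ℓ) (fun ℓ => a * ℓ ^ c + a)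
      (fun ℓ => 2 * ℓ + 1) ha hp hmono (fun q => length_encodeSkelQuery_le q.1 q.2)
    have hfun : ((fun q : ℕ × ℕ × Bool => sk q.1 q.2.1 q.2.2) ∘
        fun q : List Bool × ℕ => (q.1.length, q.2, q.1.getD q.2 false)) =
          Function.uncurry (skeletonClauses sk) := by
      funext ⟨x, i⟩
      rfl
    rw [hfun] at hC
    refine ⟨C * (c₀ + a * 3 ^ c + 2) + (C * (2 * c₀ + a * (3 ^ c + 1) + a + 1) + C),
      hC.mono fun ℓ => ?_⟩
    have hkM : ℓ ^ k ≤ ℓ ^ (c + (k + 1)) + 1 := pow_le_pow_add_one_of_le ℓ (by omega)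
    have hcM : ℓ ^ c ≤ ℓ ^ (c + (k + 1)) + 1 := pow_le_pow_add_one_of_le ℓ (by omega)
    have hℓM : ℓ ≤ ℓ ^ (c + (k + 1)) := Nat.le_self_pow (by omega) ℓ
    have h1 : p.eval ℓ ≤ c₀ * ℓ ^ (c + (k + 1)) + 2 * c₀ :=
      calc p.eval ℓ ≤ c₀ * ℓ ^ k + c₀ := hk ℓ
        _ ≤ c₀ * (ℓ ^ (c + (k + 1)) + 1) + c₀ := by gcongr
        _ = c₀ * ℓ ^ (c + (k + 1)) + 2 * c₀ := by ring
    have h2 : (2 * ℓ + 1) ^ c ≤ 3 ^ c * ℓ ^ (c + (k + 1)) + (3 ^ c + 1) :=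
      calc (2 * ℓ + 1) ^ c ≤ 3 ^ c * ℓ ^ c + 1 := two_mul_add_one_pow_le ℓ c
        _ ≤ 3 ^ c * (ℓ ^ (c + (k + 1)) + 1) + 1 := by gcongr
        _ = 3 ^ c * ℓ ^ (c + (k + 1)) + (3 ^ c + 1) := by ring
    have h3 : 2 * ℓ + 1 ≤ 2 * ℓ ^ (c + (k + 1)) + 1 := by omega
    have key : C * (p.eval ℓ + (a * (2 * ℓ + 1) ^ c + a) + (2 * ℓ + 1)) + C ≤
        (C * (c₀ + a * 3 ^ c + 2) + (C * (2 * c₀ + a * (3 ^ c + 1) + a + 1) + C)) *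
            ℓ ^ (c + (k + 1)) +
          (C * (c₀ + a * 3 ^ c + 2) + (C * (2 * c₀ + a * (3 ^ c + 1) + a + 1) + C)) :=
      calc C * (p.eval ℓ + (a * (2 * ℓ + 1) ^ c + a) + (2 * ℓ + 1)) + C
          ≤ C * ((c₀ * ℓ ^ (c + (k + 1)) + 2 * c₀) +
              (a * (3 ^ c * ℓ ^ (c + (k + 1)) + (3 ^ c + 1)) + a) +
                (2 * ℓ ^ (c + (k + 1)) + 1)) + C := by gcongr
        _ = (C * (c₀ + a * 3 ^ c + 2)) * ℓ ^ (c + (k + 1)) +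
              (C * (2 * c₀ + a * (3 ^ c + 1) + a + 1) + C) := by ring
        _ ≤ _ := Nat.add_le_add (Nat.mul_le_mul_right _ (Nat.le_add_right _ _))
              (Nat.le_add_left _ _)
    exact key
  · -- correctness, through the padding by tautologies
    rw [h.mem_iff x]
    exact h.satisfiable_iff_of_le (Nat.le_add_right c _) x

/-- Every skeleton reduction instantiates to a succinct reduction (with some constant).
[cite: Williams2014, proof sketch of Fact 3.1 (p. 8)] -/
theorem IsSkeletonReduction.exists_isSuccinctReduction {c : ℕ} {L : Language Bool}
    {sk : ℕ → ℕ → Bool → Clause ℕ} (h : IsSkeletonReduction c L sk) :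
    ∃ c' : ℕ, IsSuccinctReduction c' L (skeletonClauses sk) := by
  obtain ⟨D, hD⟩ := exists_isSuccinctReduction_of_skeleton
  exact ⟨c + D, hD c L sk h⟩

/-- **Williams 2014, Fact 3.1 from its skeleton form**: a universal constant for skeleton
reductions of `NTIME (2 ^ ·)` gives a universal constant for succinct reductions
(`Williams2014_fact_3_1`, `Williams2014Transfer.lean`), namely `c + D` with the universal shift
`D` of `exists_isSuccinctReduction_of_skeleton`. [cite: Williams2014, Fact 3.1] -/
theorem Williams2014_fact_3_1_of_skeleton (h : Williams2014_fact_3_1_skeleton) :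
    Williams2014_fact_3_1 := by
  obtain ⟨D, hD⟩ := exists_isSuccinctReduction_of_skeleton
  obtain ⟨c, hc⟩ := h
  refine ⟨c + D, fun L hL => ?_⟩
  obtain ⟨sk, hsk⟩ := hc L hL
  exact ⟨skeletonClauses sk, hD c L sk hsk⟩

/-- The same, one level up: Williams' Thm. 1.1 (`williams_acc`) from the skeleton form of
Fact 3.1, Thm. 5.1, Thm. 3.2/Lemma 3.1, the hierarchy theorem, `ACC⁰ ⊆ P/poly`, the padding
fact and the `ACC`-SAT algorithm (`williams_acc_of_components`, `Williams2014Transfer.lean`).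
[cite: Williams2014, Thm. 1.1 and its proof] -/
theorem williams_acc_of_skeleton_components (h31 : Williams2014_fact_3_1_skeleton)
    (h51 : Williams2014_thm_5_1) (h32 : Williams2014_thm_3_2) (hH : ntime_hierarchy)
    (hA : ACC0 ⊆ PPoly) (hE : NEXP_subset_PPoly_of_NTIME_two_pow_subset)
    (h41 : Williams2014_accSat_polysize) : williams_acc :=
  williams_acc_of_components (Williams2014_fact_3_1_of_skeleton h31) h51 h32 hH hA hE h41

end Literature.Computability.Complexity
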